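import Mathlib
import Literature.Computability.Complexity.RangeAvoidance
import Summits.PneNP.PneNP.Theorems.PstarSALevel

/-!
# Boundary expansion: the closure (advice set) and the peeling pigeonhole (cell `pnp-ideate`, ROUND-21 item T21.1b)

FRONTIER range-avoidance ladder, rung F-N3 context (restricted-model lower bounds for the Sherali–Adams hierarchy on typed
`P⋆`; nothing here bears on `P` vs `NP`).  Combinatorial input of the Benabbas–Georgiou–Magen–Tulsiani construction
(Theory Comput. 8 (2012), Thm 3.1 "Advice" and Claim 3.3), for the output hypergraph of a `k`-local map `I` with the
boundary `PstarSALevel.bdry` and the `(r, 3/2)`-boundary expansion `PstarSALevel.BoundaryExpanding`: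

* `exists_closure` (**the advice / closure set**): if `I` is `(r, 3/2)`-boundary expanding then every variable set `S` has a
  superset `S̄` with `|S̄| ≤ |S| + 4k·|S|` such that the instance WITH `S̄` REMOVED is `(r − 4|S|, 5/4)`-boundary expanding
  on the outputs not dominated by `S̄`: every non-empty set `M` of outputs each reading a variable outside `S̄`, with
  `|M| + 4|S| ≤ r`, has `5·|M| ≤ 4·|bdry(M) ∖ S̄|`.  The proof is extremal rather than algorithmic: `S̄ = S ∪ N(M⋆)` for a
  MAXIMUM-cardinality `M⋆` among the sets of `≤ r` outputs with `4·|bdry(M⋆) ∖ S| ≤ 5·|M⋆|` (expansion of `I` forces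
  `|M⋆| ≤ 4|S|`); a violator `M` would make `M⋆ ∪ M` a larger member of that family.
* `exists_two_private` (**the peeling pigeonhole**, the step of BGMT Claim 3.3): if `|bdry(M) ∖ T| > |M|` then some output
  of `M` owns at least two boundary variables of `M` outside `T`; with the closure this gives `exists_peelable_of_closure`:
  every non-empty non-dominated family within budget has a member with two private variables outside `S̄`.
-/

set_option linter.dupNamespace false

open Finset Literature.Computability.Complexity
open Summit.PneNP.PneNP.Theorems.PstarSALevel (varSet bdry BoundaryExpanding)

namespace Summit.PneNP.PneNP.Theorems.PstarSAClosure

variable {k n m : ℕ}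

/-! ## Neighbourhoods, degrees, boundaries -/

/-- The variables read by a set of outputs, `N(M)`. -/
def nbhd (I : LocalMap k n m) (M : Finset (Fin m)) : Finset (Fin n) := M.biUnion (varSet I)

/-- The number of outputs of `J` reading `v`. -/
def degIn (I : LocalMap k n m) (J : Finset (Fin m)) (v : Fin n) : ℕ := (J.filter fun j => v ∈ varSet I j).card

/-- Membership in the boundary: read by exactly one output of `J`. -/
theorem mem_bdry_iff (I : LocalMap k n m) (J : Finset (Fin m)) (v : Fin n) : v ∈ bdry I J ↔ degIn I J v = 1 := by
  simp [PstarSALevel.bdry, degIn]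

/-- An output reads at most `k` variables. -/
theorem card_varSet_le (I : LocalMap k n m) (j : Fin m) : (varSet I j).card ≤ k := by
  unfold PstarSALevel.varSet
  exact Finset.card_image_le.trans (by simp)

/-- `|N(M)| ≤ k·|M|`. -/
theorem card_nbhd_le (I : LocalMap k n m) (M : Finset (Fin m)) : (nbhd I M).card ≤ k * M.card := by
  unfold nbhd
  refine Finset.card_biUnion_le.trans ?_
  calc ∑ j ∈ M, (varSet I j).card ≤ ∑ _j ∈ M, k := Finset.sum_le_sum fun j _ => card_varSet_le I j
    _ = k * M.card := by rw [Finset.sum_const, smul_eq_mul, Nat.mul_comm]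

/-- A variable of an output of `M` is in `N(M)`. -/
theorem mem_nbhd (I : LocalMap k n m) {M : Finset (Fin m)} {j : Fin m} (hj : j ∈ M) {v : Fin n} (hv : v ∈ varSet I j) :
    v ∈ nbhd I M :=
  Finset.mem_biUnion.2 ⟨j, hj, hv⟩

/-- A variable outside `N(M)` is read by no output of `M`. -/
theorem degIn_eq_zero_of_not_mem_nbhd (I : LocalMap k n m) (M : Finset (Fin m)) {v : Fin n} (hv : v ∉ nbhd I M) :
    degIn I M v = 0 := by
  unfold degIn
  rw [Finset.card_eq_zero, Finset.filter_eq_empty_iff]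
  exact fun j hj hvj => hv (mem_nbhd I hj hvj)

/-- A variable read by no output of `M` is outside `N(M)`. -/
theorem not_mem_nbhd_of_degIn_eq_zero (I : LocalMap k n m) (M : Finset (Fin m)) {v : Fin n} (hv : degIn I M v = 0) :
    v ∉ nbhd I M := by
  intro h
  obtain ⟨j, hj, hvj⟩ := Finset.mem_biUnion.1 h
  unfold degIn at hv
  rw [Finset.card_eq_zero, Finset.filter_eq_empty_iff] at hv
  exact hv hj hvj

/-- Degrees add over disjoint output sets. -/
theorem degIn_union (I : LocalMap k n m) {A B : Finset (Fin m)} (h : Disjoint A B) (v : Fin n) :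
    degIn I (A ∪ B) v = degIn I A v + degIn I B v := by
  unfold degIn
  rw [Finset.filter_union, Finset.card_union_of_disjoint (Finset.disjoint_filter_filter h)]

/-- **Boundary of a union with a separated part.**  If `M` is disjoint from `M⋆` then every boundary variable of
`M⋆ ∪ M` outside `S` is a boundary variable of `M⋆` outside `S` or a boundary variable of `M` outside `S ∪ N(M⋆)`. -/
theorem bdry_union_sdiff_subset (I : LocalMap k n m) (Ms M : Finset (Fin m)) (S : Finset (Fin n))
    (hdisj : Disjoint Ms M) :
    bdry I (Ms ∪ M) \ S ⊆ (bdry I Ms \ S) ∪ (bdry I M \ (S ∪ nbhd I Ms)) := by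
  intro v hv
  rw [Finset.mem_sdiff, mem_bdry_iff, degIn_union I hdisj] at hv
  obtain ⟨hdeg, hvS⟩ := hv
  rw [Finset.mem_union, Finset.mem_sdiff, Finset.mem_sdiff, mem_bdry_iff, mem_bdry_iff, Finset.mem_union]
  by_cases h1 : degIn I Ms v = 1
  · exact Or.inl ⟨h1, hvS⟩
  · have h0 : degIn I Ms v = 0 := by omega
    exact Or.inr ⟨by omega, fun h => h.elim hvS (not_mem_nbhd_of_degIn_eq_zero I Ms h0)⟩

/-- An output dominated by `S ∪ N(M⋆)`... conversely: an output of `M⋆` reads only variables of `N(M⋆)`. -/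
theorem varSet_subset_nbhd (I : LocalMap k n m) {M : Finset (Fin m)} {j : Fin m} (hj : j ∈ M) : varSet I j ⊆ nbhd I M :=
  fun _ hv => mem_nbhd I hj hv

/-! ## The closure (advice set) -/

/-- **The closure / advice set (BGMT Thm 3.1).**  If `I` is `(r, 3/2)`-boundary expanding then every `S` has a superset
`S̄`, `|S̄| ≤ |S| + k·(4|S|)`, such that every non-empty set `M` of outputs NOT dominated by `S̄` with `|M| + 4|S| ≤ r`
satisfies `5·|M| ≤ 4·|bdry(M) ∖ S̄|`. -/
theorem exists_closure (I : LocalMap k n m) (r : ℕ) (hexp : BoundaryExpanding r I) (S : Finset (Fin n)) :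
    ∃ Sb : Finset (Fin n), S ⊆ Sb ∧ Sb.card ≤ S.card + k * (4 * S.card) ∧
      ∀ M : Finset (Fin m), M.Nonempty → (∀ j ∈ M, ¬ varSet I j ⊆ Sb) → M.card + 4 * S.card ≤ r →
        5 * M.card ≤ 4 * (bdry I M \ Sb).card := by
  classical
  -- the sets of `≤ r` outputs with small boundary outside `S`, and a maximum-cardinality member `Ms`
  set F : Finset (Finset (Fin m)) :=
    univ.filter fun M => M.card ≤ r ∧ 4 * (bdry I M \ S).card ≤ 5 * M.card with hF
  have hbd0 : bdry I (∅ : Finset (Fin m)) = ∅ := by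
    ext v; simp [PstarSALevel.bdry]
  have hFne : F.Nonempty := ⟨∅, by simp [hF, hbd0]⟩
  obtain ⟨Ms, hMsF, hmax⟩ := Finset.exists_max_image F Finset.card hFne
  have hMs : Ms.card ≤ r ∧ 4 * (bdry I Ms \ S).card ≤ 5 * Ms.card := by simpa [hF] using hMsF
  -- expansion of `I` bounds `|Ms|`
  have hMs_le : Ms.card ≤ 4 * S.card := by
    have h1 := hexp Ms hMs.1
    have h2 := Finset.card_le_card_sdiff_add_card (s := bdry I Ms) (t := S)
    omega
  refine ⟨S ∪ nbhd I Ms, Finset.subset_union_left, ?_, ?_⟩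
  · calc (S ∪ nbhd I Ms).card ≤ S.card + (nbhd I Ms).card := Finset.card_union_le _ _
      _ ≤ S.card + k * Ms.card := by have := card_nbhd_le I Ms; omega
      _ ≤ S.card + k * (4 * S.card) := by have := Nat.mul_le_mul_left k hMs_le; omega
  · intro M hMne hnd hbudget
    by_contra hlt
    push Not at hlt
    have hdisj : Disjoint Ms M := by
      rw [Finset.disjoint_right]
      intro j hjM hjMs
      exact hnd j hjM ((varSet_subset_nbhd I hjMs).trans Finset.subset_union_right)
    have hcard : (Ms ∪ M).card = Ms.card + M.card := Finset.card_union_of_disjoint hdisj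
    have hbd : (bdry I (Ms ∪ M) \ S).card ≤ (bdry I Ms \ S).card + (bdry I M \ (S ∪ nbhd I Ms)).card :=
      (Finset.card_le_card (bdry_union_sdiff_subset I Ms M S hdisj)).trans (Finset.card_union_le _ _)
    have hmem : Ms ∪ M ∈ F := by
      simp only [hF, Finset.mem_filter, Finset.mem_univ, true_and]
      exact ⟨by omega, by omega⟩
    have hle := hmax _ hmem
    have hpos := hMne.card_pos
    omega

/-! ## The peeling pigeonhole -/

/-- **Pigeonhole (the step of BGMT Claim 3.3).**  If `M` has more boundary variables outside `T` than members, some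
member owns at least two of them (they are PRIVATE to it: read by no other member of `M`, and outside `T`). -/
theorem exists_two_private (I : LocalMap k n m) (M : Finset (Fin m)) (T : Finset (Fin n))
    (h : M.card < (bdry I M \ T).card) :
    ∃ j ∈ M, 2 ≤ ((bdry I M \ T).filter fun v => v ∈ varSet I j).card := by
  classical
  by_contra hno
  push Not at hno
  have hcov : bdry I M \ T ⊆ M.biUnion fun j => (bdry I M \ T).filter fun v => v ∈ varSet I j := by
    intro v hv
    have hv' := (Finset.mem_sdiff.1 hv).1
    rw [mem_bdry_iff] at hv'
    obtain ⟨j, hj⟩ : (M.filter fun j => v ∈ varSet I j).Nonempty := by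
      rw [← Finset.card_pos]; unfold degIn at hv'; omega
    rw [Finset.mem_filter] at hj
    exact Finset.mem_biUnion.2 ⟨j, hj.1, Finset.mem_filter.2 ⟨hv, hj.2⟩⟩
  have h1 := (Finset.card_le_card hcov).trans Finset.card_biUnion_le
  have hsum : ∑ j ∈ M, ((bdry I M \ T).filter fun v => v ∈ varSet I j).card ≤ ∑ _j ∈ M, 1 :=
    Finset.sum_le_sum fun j hj => by have := hno j hj; omega
  rw [Finset.sum_const, smul_eq_mul, mul_one] at hsum
  omega

/-- **Closure + pigeonhole = peelability.**  Under `(r, 3/2)`-boundary expansion, every `S` has a closure `S̄`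
(`|S̄| ≤ |S| + 4k|S|`) such that every non-empty family of outputs not dominated by `S̄`, of size `≤ r − 4|S|`, has a
member with at least two private variables outside `S̄` (the ordering step of BGMT Claim 3.3, iterable since sub-families
of a non-dominated family are non-dominated). -/
theorem exists_peelable_of_closure (I : LocalMap k n m) (r : ℕ) (hexp : BoundaryExpanding r I) (S : Finset (Fin n)) :
    ∃ Sb : Finset (Fin n), S ⊆ Sb ∧ Sb.card ≤ S.card + k * (4 * S.card) ∧
      ∀ M : Finset (Fin m), M.Nonempty → (∀ j ∈ M, ¬ varSet I j ⊆ Sb) → M.card + 4 * S.card ≤ r →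
        ∃ j ∈ M, 2 ≤ ((bdry I M \ Sb).filter fun v => v ∈ varSet I j).card := by
  obtain ⟨Sb, hS, hcard, hexp'⟩ := exists_closure I r hexp S
  refine ⟨Sb, hS, hcard, fun M hMne hnd hbudget => exists_two_private I M Sb ?_⟩
  have := hexp' M hMne hnd hbudget
  have := hMne.card_pos
  omega

/-- A private variable in the sense above is read by `j` and by no other member of `M`, and lies outside `T`. -/
theorem private_spec (I : LocalMap k n m) (M : Finset (Fin m)) (T : Finset (Fin n)) (j : Fin m) (hj : j ∈ M)
    (v : Fin n) (hv : v ∈ (bdry I M \ T).filter fun v => v ∈ varSet I j) :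
    v ∈ varSet I j ∧ v ∉ T ∧ ∀ j' ∈ M, j' ≠ j → v ∉ varSet I j' := by
  classical
  rw [Finset.mem_filter, Finset.mem_sdiff, mem_bdry_iff] at hv
  obtain ⟨⟨hdeg, hvT⟩, hvj⟩ := hv
  refine ⟨hvj, hvT, fun j' hj' hne hvj' => ?_⟩
  unfold degIn at hdeg
  have h2 : 2 ≤ (M.filter fun j => v ∈ varSet I j).card := by
    have hsub : ({j, j'} : Finset (Fin m)) ⊆ M.filter fun j => v ∈ varSet I j := by
      intro x hx
      rw [Finset.mem_insert, Finset.mem_singleton] at hx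
      rw [Finset.mem_filter]
      rcases hx with rfl | rfl
      · exact ⟨hj, hvj⟩
      · exact ⟨hj', hvj'⟩
    have := Finset.card_le_card hsub
    rwa [Finset.card_pair hne.symm] at this
  omega

/-! ## Budget: few outputs are dominated by a small set -/

/-- The boundary of a family of outputs dominated by `V` lies in `V`. -/
theorem bdry_subset_of_dominated (I : LocalMap k n m) (V : Finset (Fin n)) (J : Finset (Fin m))
    (hJ : ∀ j ∈ J, varSet I j ⊆ V) : bdry I J ⊆ V := by
  classical
  intro v hv
  rw [mem_bdry_iff] at hv
  obtain ⟨j, hj⟩ : (J.filter fun j => v ∈ varSet I j).Nonempty := by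
    rw [← Finset.card_pos]; unfold degIn at hv; omega
  rw [Finset.mem_filter] at hj
  exact hJ j hj.1 hj.2

/-- **Budget lemma.**  Under `(r, 3/2)`-boundary expansion a variable set `V` with `2|V| < 3r` dominates at most `2|V|/3`
outputs: every family `J` of outputs each reading only variables of `V` has `3·|J| ≤ 2·|V|` (so `|J| < r`). -/
theorem card_le_of_dominated (I : LocalMap k n m) (r : ℕ) (hexp : BoundaryExpanding r I) (V : Finset (Fin n))
    (hV : 2 * V.card < 3 * r) (J : Finset (Fin m)) (hJ : ∀ j ∈ J, varSet I j ⊆ V) : 3 * J.card ≤ 2 * V.card := by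
  by_cases hr : J.card ≤ r
  · exact (hexp J hr).trans (Nat.mul_le_mul_left 2 (Finset.card_le_card (bdry_subset_of_dominated I V J hJ)))
  · exfalso
    obtain ⟨J', hJ'J, hcard⟩ := Finset.exists_subset_card_eq (show r ≤ J.card by omega)
    have h1 := hexp J' hcard.le
    have h2 := Finset.card_le_card (bdry_subset_of_dominated I V J' fun j hj => hJ j (hJ'J hj))
    omega

end Summit.PneNP.PneNP.Theorems.PstarSAClosure
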